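import Summits.Ventures.YMGap.Thresholds.OneLinkLevelTwoQuad
import Summits.Ventures.YMGap.Thresholds.OneLinkRemainderPrimeL2
import Summits.Ventures.YMGap.Thresholds.OneLinkLevelTwoBootAlgebra
import Summits.Ventures.YMGap.Thresholds.OneLinkPoissonCovarianceSplit
import HarnessLib

/-!
# Venture YMGap — the one-link modulus beyond first order, part 45: the LINEAR-BOOTSTRAP level-two one-link
# Kantorovich–Rubinstein modulus `K₂B(N, R)`, every `SU(N)`, `N ≥ 3`, hypothesis-free

HONEST FRAMING: venture file of the cell `pub-ymgap` (QuantumFields programme), strong-coupling LATTICE bookkeeping for `SU(N)`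
lattice Yang–Mills; nothing about the continuum or the mass gap in the Clay sense.  Same ingredients as `OneLinkLevelTwoQuad`
(`K₂Q`: ω-refined A-part, quadratic words in `L²`), with ONE change in the engine: the LINEAR part `Re tr(·M_ℓ)` of the cubic
remainder (`T_b + T_d3 + T_d4`, `‖M_ℓ‖_F ≤ ‖Δ‖_F(κ_w r² + κ_t‖B‖_F²) ≤ (3E/2) r²‖Δ‖_F`) is NOT sent through Bakry–Émery
(`1/(½−R)`) but bounded by the already-landed modulus bound `cov_linear_le_levelTwoQ_explicit` applied to `Δ := M_ℓ` (nesting;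
engine `OneLinkPoissonCovarianceSplit.cov_linear_le_of_poisson_split`, split identity `OneLinkRemainderPrime.c3_split`).

WHAT.  `K₂B(N,R) = C·( √((1+ω⁺)/2) + E R + 2(E+¼)ω̂ + [ (3E/2)R² + (2E+¼)τ + (10E+½)R ω̂ ] / (½ − R) + (3E/2)R²·K₂Q(N,R) )`
(symbols as in `OneLinkLevelTwoQuad`).
* (assembly: `OneLinkLevelTwoBootAlgebra.levelTwo_algebraWAQB`);
* `cov_linear_le_levelTwoB_explicit`: `|Cov_{ν_B}(φ, N Re tr(·Δ))| ≤ K₂B(N, ‖B‖_op)·L·‖Δ‖_F`;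
* `levelTwoQBody_nonneg`, `levelTwoBBody_mono`; `oneLinkKRModulus_levelTwoB (hN : 3 ≤ N) (hR : R < 1/2) : OneLinkKRModulus N R (K₂B(N,R))`.
Numbers (float screen `work/hier` of this seat): `K₂B(10, 0.24) = 1.81` against `K₂Q = 1.89`; star-door rows `0.0378 | 0.0413 | 0.0432 |
0.0442 | 0.0445` for `N ≥ 4 | 6 | 10 | 20 | 50` (next file).  Sentence-grade.

References: cell note `HOME/p2/ONE-LINK-HIERARCHY.md` §15 (1).
-/

noncomputable section

open scoped Matrix ComplexConjugate BigOperators ContDiff Matrix.Norms.Frobenius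
open Matrix Complex Finset MeasureTheory ProbabilityTheory
open Literature.MathematicalPhysics.QuantumFieldTheory
open Literature.MathematicalPhysics.QuantumFieldTheory.SUNBakryEmery
open Literature.MathematicalPhysics.QuantumFieldTheory.Balaban1983to89.StrongCouplingDobrushinWindow
open Literature.MathematicalPhysics.QuantumFieldTheory.Balaban1983to89.StrongCouplingKernelWindow

namespace Summit.Ventures.YMGap.OneLinkEigen

variable {N : ℕ}

/-! ### The explicit bootstrap bound -/

/-- `pot 1 ((N : ℂ) • X) Q = N · Re tr(Q X)`. [folklore] -/
theorem pot_one_natSmul (X Q : Matrix (Fin N) (Fin N) ℂ) :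
    pot 1 ((N : ℂ) • X) Q = (N : ℝ) * (Q * X).trace.re := by
  simp only [pot, one_mul, Matrix.mul_smul, trace_smul, smul_eq_mul, Complex.mul_re, Complex.natCast_re, Complex.natCast_im,
    zero_mul, sub_zero]

/-- **THE LINEAR-BOOTSTRAP COVARIANCE BOUND, explicit.**  `N ≥ 3`, `‖B‖_op < 1/2`, `φ` bounded measurable `L`-Lipschitz on `SU(N)`:
`|∫ φ · N Re tr(gΔ) dν_B − ∫ φ dν_B ∫ N Re tr(gΔ) dν_B| ≤ K₂B(N, ‖B‖_op) · L · ‖Δ‖_F`. [folklore] -/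
theorem cov_linear_le_levelTwoB_explicit (hN : 3 ≤ N) {B : Matrix (Fin N) (Fin N) ℂ} (hB : matrixOpNorm B < 1 / 2)
    (Δ : Matrix (Fin N) (Fin N) ℂ) (φ : SUN N → ℝ) {L : ℝ} (hφm : Measurable φ) (hφb : ∃ C, ∀ s, |φ s| ≤ C)
    (hL : 0 ≤ L) (hφL : ∀ a b, |φ a - φ b| ≤ L * suFrobDist a b) :
    |∫ s, φ s * ((N : ℝ) * ((s : Matrix (Fin N) (Fin N) ℂ) * Δ).trace.re)
          ∂(haarProbability (SUN N)).tilted (fun g => (N : ℝ) * ((g : Matrix (Fin N) (Fin N) ℂ) * B).trace.re) -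
        (∫ s, φ s ∂(haarProbability (SUN N)).tilted (fun g => (N : ℝ) * ((g : Matrix (Fin N) (Fin N) ℂ) * B).trace.re)) *
          ∫ s, (N : ℝ) * ((s : Matrix (Fin N) (Fin N) ℂ) * Δ).trace.re
            ∂(haarProbability (SUN N)).tilted (fun g => (N : ℝ) * ((g : Matrix (Fin N) (Fin N) ℂ) * B).trace.re)| ≤
      ((N : ℝ) ^ 2 / ((N : ℝ) ^ 2 - 1)) *
        (Real.sqrt ((1 +
            (2 * ((N : ℝ) * (2 * (N : ℝ) - 4 / N) / ((2 * (N : ℝ) - 4 / N) ^ 2 - 4)) *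
            (matrixOpNorm B + (matrixOpNorm B ^ 2 / 2 + matrixOpNorm B * Real.sqrt (matrixOpNorm B ^ 2 / 4 + 1 / (N : ℝ) ^ 2)))
          + 2 * (2 * (N : ℝ) / ((2 * (N : ℝ) - 4 / N) ^ 2 - 4)) * N *
            ((matrixOpNorm B ^ 2 / 2 + matrixOpNorm B * Real.sqrt (matrixOpNorm B ^ 2 / 4 + 1 / (N : ℝ) ^ 2))
              + matrixOpNorm B * (matrixOpNorm B / 2 + Real.sqrt (matrixOpNorm B ^ 2 / 4 + 1 / (N : ℝ) ^ 2)) ^ 2))) / 2)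
          + ((N : ℝ) ^ 2 / (2 * ((N : ℝ) ^ 2 - 4))) * matrixOpNorm B + 2 * (((N : ℝ) ^ 2 / (2 * ((N : ℝ) ^ 2 - 4))) + 1 / 4) * (matrixOpNorm B ^ 2 / 2 + matrixOpNorm B * Real.sqrt (matrixOpNorm B ^ 2 / 4 + 1 / (N : ℝ) ^ 2))
          + (3 / 2 * ((N : ℝ) ^ 2 / (2 * ((N : ℝ) ^ 2 - 4))) * matrixOpNorm B ^ 2 + (2 * ((N : ℝ) ^ 2 / (2 * ((N : ℝ) ^ 2 - 4))) + 1 / 4) * (matrixOpNorm B * ((matrixOpNorm B ^ 2 * (1 + matrixOpNorm B / 2 + Real.sqrt (matrixOpNorm B ^ 2 / 4 + 1 / (N : ℝ) ^ 2)) / (2 - 4 / (N : ℝ) ^ 2)) / 2 + Real.sqrt ((matrixOpNorm B ^ 2 * (1 + matrixOpNorm B / 2 + Real.sqrt (matrixOpNorm B ^ 2 / 4 + 1 / (N : ℝ) ^ 2)) / (2 - 4 / (N : ℝ) ^ 2)) ^ 2 / 4 + (matrixOpNorm B ^ 2 * (4 / (N : ℝ) ^ 2 + 2 * (matrixOpNorm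 B / 2 + Real.sqrt (matrixOpNorm B ^ 2 / 4 + 1 / (N : ℝ) ^ 2)) ^ 2) / (2 - 4 / (N : ℝ) ^ 2)))))
              + (10 * ((N : ℝ) ^ 2 / (2 * ((N : ℝ) ^ 2 - 4))) + 1 / 2) * matrixOpNorm B * (matrixOpNorm B ^ 2 / 2 + matrixOpNorm B * Real.sqrt (matrixOpNorm B ^ 2 / 4 + 1 / (N : ℝ) ^ 2))) / (1 / 2 - matrixOpNorm B)
          + 3 / 2 * ((N : ℝ) ^ 2 / (2 * ((N : ℝ) ^ 2 - 4))) * matrixOpNorm B ^ 2 * (((N : ℝ) ^ 2 / ((N : ℝ) ^ 2 - 1)) *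
        (Real.sqrt ((1 +
            (2 * ((N : ℝ) * (2 * (N : ℝ) - 4 / N) / ((2 * (N : ℝ) - 4 / N) ^ 2 - 4)) *
            (matrixOpNorm B + (matrixOpNorm B ^ 2 / 2 + matrixOpNorm B * Real.sqrt (matrixOpNorm B ^ 2 / 4 + 1 / (N : ℝ) ^ 2)))
          + 2 * (2 * (N : ℝ) / ((2 * (N : ℝ) - 4 / N) ^ 2 - 4)) * N *
            ((matrixOpNorm B ^ 2 / 2 + matrixOpNorm B * Real.sqrt (matrixOpNorm B ^ 2 / 4 + 1 / (N : ℝ) ^ 2))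
              + matrixOpNorm B * (matrixOpNorm B / 2 + Real.sqrt (matrixOpNorm B ^ 2 / 4 + 1 / (N : ℝ) ^ 2)) ^ 2))) / 2)
          + ((N : ℝ) ^ 2 / (2 * ((N : ℝ) ^ 2 - 4))) * matrixOpNorm B + 2 * (((N : ℝ) ^ 2 / (2 * ((N : ℝ) ^ 2 - 4))) + 1 / 4) * (matrixOpNorm B ^ 2 / 2 + matrixOpNorm B * Real.sqrt (matrixOpNorm B ^ 2 / 4 + 1 / (N : ℝ) ^ 2))
          + (3 * ((N : ℝ) ^ 2 / (2 * ((N : ℝ) ^ 2 - 4))) * matrixOpNorm B ^ 2 + (2 * ((N : ℝ) ^ 2 / (2 * ((N : ℝ) ^ 2 - 4))) + 1 / 4) * (matrixOpNorm B * ((matrixOpNorm B ^ 2 * (1 + matrixOpNorm B / 2 + Real.sqrt (matrixOpNorm B ^ 2 / 4 + 1 / (N : ℝ) ^ 2)) / (2 - 4 / (N : ℝ) ^ 2)) / 2 + Real.sqrt ((matrixOpNorm B ^ 2 * (1 + matrixOpNorm B / 2 + Real.sqrt (matrixOpNorm B ^ 2 / 4 + 1 / (N : ℝ) ^ 2)) /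 (2 - 4 / (N : ℝ) ^ 2)) ^ 2 / 4 + (matrixOpNorm B ^ 2 * (4 / (N : ℝ) ^ 2 + 2 * (matrixOpNorm B / 2 + Real.sqrt (matrixOpNorm B ^ 2 / 4 + 1 / (N : ℝ) ^ 2)) ^ 2) / (2 - 4 / (N : ℝ) ^ 2)))))
              + (10 * ((N : ℝ) ^ 2 / (2 * ((N : ℝ) ^ 2 - 4))) + 1 / 2) * matrixOpNorm B * (matrixOpNorm B ^ 2 / 2 + matrixOpNorm B * Real.sqrt (matrixOpNorm B ^ 2 / 4 + 1 / (N : ℝ) ^ 2))) / (1 / 2 - matrixOpNorm B)))) * L * frobNorm Δ := by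
  have hN0 : N ≠ 0 := by omega
  have hN2 : 2 ≤ N := by omega
  have h3 : (3 : ℝ) ≤ N := by exact_mod_cast hN
  have hNpos : (0 : ℝ) < N := by linarith
  have hNne : (N : ℝ) ≠ 0 := hNpos.ne'
  have hr0 := matrixOpNorm_nonneg B
  have hB0 := frobNorm_nonneg B
  have hD0 := frobNorm_nonneg Δ
  have hW := levelTwoS_scale hNpos hB0 (frobNorm_le_sqrt_mul_matrixOpNorm B) hr0
  have hW0 : 0 ≤ (N : ℝ) * (matrixOpNorm B ^ 2 / 2 + matrixOpNorm B * Real.sqrt (matrixOpNorm B ^ 2 / 4 + 1 / (N : ℝ) ^ 2)) :=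
    mul_nonneg hNpos.le (levelTwoS_om_nonneg hr0)
  have hZ1 : Real.sqrt (∫ g, ‖((g : Matrix (Fin N) (Fin N) ℂ) * B).trace‖ ^ 2 ∂(haarProbability (SUN N)).tilted (fun g => (N : ℝ) * ((g : Matrix (Fin N) (Fin N) ℂ) * B).trace.re)) ≤
      (N : ℝ) * (matrixOpNorm B ^ 2 / 2 + matrixOpNorm B * Real.sqrt (matrixOpNorm B ^ 2 / 4 + 1 / (N : ℝ) ^ 2)) :=
    (sqrt_integral_normSq_trace_le_sd hN0 B B).trans hW
  have hZ2 : frobNorm B * Real.sqrt (∫ g, ‖((g : Matrix (Fin N) (Fin N) ℂ) * Δ).trace‖ ^ 2 ∂(haarProbability (SUN N)).tilted (fun g => (N : ℝ) * ((g : Matrix (Fin N) (Fin N) ℂ) * B).trace.re)) ≤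
      frobNorm Δ * ((N : ℝ) * (matrixOpNorm B ^ 2 / 2 + matrixOpNorm B * Real.sqrt (matrixOpNorm B ^ 2 / 4 + 1 / (N : ℝ) ^ 2))) := by
    have h := sqrt_integral_normSq_trace_le_sd hN0 B Δ
    calc frobNorm B * Real.sqrt (∫ g, ‖((g : Matrix (Fin N) (Fin N) ℂ) * Δ).trace‖ ^ 2 ∂(haarProbability (SUN N)).tilted (fun g => (N : ℝ) * ((g : Matrix (Fin N) (Fin N) ℂ) * B).trace.re))
        ≤ frobNorm B * (frobNorm Δ * (frobNorm B / 2 + Real.sqrt (frobNorm B ^ 2 / 4 + 1 / N))) := mul_le_mul_of_nonneg_left h hB0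
      _ = frobNorm Δ * (frobNorm B * (frobNorm B / 2 + Real.sqrt (frobNorm B ^ 2 / 4 + 1 / N))) := by ring
      _ ≤ _ := mul_le_mul_of_nonneg_left hW hD0
  -- the engine with the split remainder
  have hcov := cov_linear_le_of_poisson_split hN2 hB Δ (contDiff_psiTwo N B Δ) (contDiff_c3prime N B Δ)
    ((N : ℂ) • ((-((((N : ℝ) ^ 2 / (4 * ((N : ℝ) ^ 2 - 4))) / 2 : ℝ) : ℂ)) • (B * Bᴴ * Δ + Δ * Bᴴ * B)
          + ((1 / 2 : ℝ) : ℂ) • (((((N : ℝ) / (2 * ((N : ℝ) ^ 2 - 4)) : ℝ) : ℂ) * (B * Bᴴ).trace - ((1 / (4 * (N : ℝ)) : ℝ) : ℂ) * (starRingEnd ℂ) (B * Bᴴ).trace) • Δ + ((((N : ℝ) / (2 * ((N : ℝ) ^ 2 - 4)) : ℝ) : ℂ) * (Δ * Bᴴ).trace - ((1 / (4 * (N : ℝ)) : ℝ) : ℂ) * (starRingEnd ℂ) (Δ * Bᴴ).trace) • B))) (fun g => c3_split hN B Δ g) φ hφm hφb hL hφL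
  -- the nested linear term through the level-two modulus bound with `Δ := M_ℓ`
  set Mℓ : Matrix (Fin N) (Fin N) ℂ := ((-((((N : ℝ) ^ 2 / (4 * ((N : ℝ) ^ 2 - 4))) / 2 : ℝ) : ℂ)) • (B * Bᴴ * Δ + Δ * Bᴴ * B)
          + ((1 / 2 : ℝ) : ℂ) • (((((N : ℝ) / (2 * ((N : ℝ) ^ 2 - 4)) : ℝ) : ℂ) * (B * Bᴴ).trace - ((1 / (4 * (N : ℝ)) : ℝ) : ℂ) * (starRingEnd ℂ) (B * Bᴴ).trace) • Δ + ((((N : ℝ) / (2 * ((N : ℝ) ^ 2 - 4)) : ℝ) : ℂ) * (Δ * Bᴴ).trace - ((1 / (4 * (N : ℝ)) : ℝ) : ℂ) * (starRingEnd ℂ) (Δ * Bᴴ).trace) • B)) with hMℓ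
  have hlin := cov_linear_le_levelTwoQ_explicit hN hB Mℓ φ hφm hφb hL hφL
  have epot : (fun s : SUN N => φ s * pot 1 ((N : ℂ) • Mℓ) (s : Matrix (Fin N) (Fin N) ℂ)) =
      fun s : SUN N => φ s * ((N : ℝ) * ((s : Matrix (Fin N) (Fin N) ℂ) * Mℓ).trace.re) := by
    funext s; rw [pot_one_natSmul]
  have epot' : (fun s : SUN N => pot 1 ((N : ℂ) • Mℓ) (s : Matrix (Fin N) (Fin N) ℂ)) =
      fun s : SUN N => (N : ℝ) * ((s : Matrix (Fin N) (Fin N) ℂ) * Mℓ).trace.re := by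
    funext s; rw [pot_one_natSmul]
  rw [epot, epot'] at hcov
  -- the Frobenius norm of `M_ℓ` from that of `N • M_ℓ`
  have hbig := frobNorm_linPart_le hN B Δ
  have hnM : frobNorm Mℓ ≤ frobNorm Δ * (((N : ℝ) ^ 2 / (4 * ((N : ℝ) ^ 2 - 4))) * matrixOpNorm B ^ 2
      + ((N : ℝ) / (2 * ((N : ℝ) ^ 2 - 4))) * frobNorm B ^ 2) := by
    rw [← hMℓ, frobNorm_smul, Complex.norm_natCast] at hbig
    exact le_of_mul_le_mul_left hbig hNpos
  have hKQ : 0 ≤ ((N : ℝ) ^ 2 / ((N : ℝ) ^ 2 - 1)) *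
        (Real.sqrt ((1 +
            (2 * ((N : ℝ) * (2 * (N : ℝ) - 4 / N) / ((2 * (N : ℝ) - 4 / N) ^ 2 - 4)) *
            (matrixOpNorm B + (matrixOpNorm B ^ 2 / 2 + matrixOpNorm B * Real.sqrt (matrixOpNorm B ^ 2 / 4 + 1 / (N : ℝ) ^ 2)))
          + 2 * (2 * (N : ℝ) / ((2 * (N : ℝ) - 4 / N) ^ 2 - 4)) * N *
            ((matrixOpNorm B ^ 2 / 2 + matrixOpNorm B * Real.sqrt (matrixOpNorm B ^ 2 / 4 + 1 / (N : ℝ) ^ 2))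
              + matrixOpNorm B * (matrixOpNorm B / 2 + Real.sqrt (matrixOpNorm B ^ 2 / 4 + 1 / (N : ℝ) ^ 2)) ^ 2))) / 2)
          + ((N : ℝ) ^ 2 / (2 * ((N : ℝ) ^ 2 - 4))) * matrixOpNorm B + 2 * (((N : ℝ) ^ 2 / (2 * ((N : ℝ) ^ 2 - 4))) + 1 / 4) * (matrixOpNorm B ^ 2 / 2 + matrixOpNorm B * Real.sqrt (matrixOpNorm B ^ 2 / 4 + 1 / (N : ℝ) ^ 2))
          + (3 * ((N : ℝ) ^ 2 / (2 * ((N : ℝ) ^ 2 - 4))) * matrixOpNorm B ^ 2 + (2 * ((N : ℝ) ^ 2 / (2 * ((N : ℝ) ^ 2 - 4))) + 1 / 4) * (matrixOpNorm B * ((matrixOpNorm B ^ 2 * (1 + matrixOpNorm B / 2 + Real.sqrt (matrixOpNorm B ^ 2 / 4 + 1 / (N : ℝ) ^ 2)) / (2 - 4 / (N : ℝ) ^ 2)) / 2 + Real.sqrt ((matrixOpNorm B ^ 2 * (1 + matrixOpNorm B / 2 + Real.sqrt (matrixOpNorm B ^ 2 / 4 + 1 / (N : ℝ) ^ 2)) /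 (2 - 4 / (N : ℝ) ^ 2)) ^ 2 / 4 + (matrixOpNorm B ^ 2 * (4 / (N : ℝ) ^ 2 + 2 * (matrixOpNorm B / 2 + Real.sqrt (matrixOpNorm B ^ 2 / 4 + 1 / (N : ℝ) ^ 2)) ^ 2) / (2 - 4 / (N : ℝ) ^ 2)))))
              + (10 * ((N : ℝ) ^ 2 / (2 * ((N : ℝ) ^ 2 - 4))) + 1 / 2) * matrixOpNorm B * (matrixOpNorm B ^ 2 / 2 + matrixOpNorm B * Real.sqrt (matrixOpNorm B ^ 2 / 4 + 1 / (N : ℝ) ^ 2))) / (1 / 2 - matrixOpNorm B)) := by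
    have : 0 ≤ (N : ℝ) ^ 2 / ((N : ℝ) ^ 2 - 1) := div_nonneg (by positivity) (by nlinarith only [h3])
    have : 0 ≤ (N : ℝ) ^ 2 / (2 * ((N : ℝ) ^ 2 - 4)) := div_nonneg (by positivity) (by nlinarith only [h3])
    have : 0 < 1 / 2 - matrixOpNorm B := by linarith only [hB]
    have : 0 ≤ (matrixOpNorm B * ((matrixOpNorm B ^ 2 * (1 + matrixOpNorm B / 2 + Real.sqrt (matrixOpNorm B ^ 2 / 4 + 1 / (N : ℝ) ^ 2)) / (2 - 4 / (N : ℝ) ^ 2)) / 2 + Real.sqrt ((matrixOpNorm B ^ 2 * (1 + matrixOpNorm B / 2 + Real.sqrt (matrixOpNorm B ^ 2 / 4 + 1 / (N : ℝ) ^ 2)) / (2 - 4 / (N : ℝ) ^ 2)) ^ 2 / 4 + (matrixOpNorm B ^ 2 * (4 / (N : ℝ) ^ 2 + 2 * (matrixOpNorm B / 2 + Real.sqrt (matrixOpNorm B ^ 2 / 4 + 1 / (N : ℝ) ^ 2)) ^ 2) / (2 - 4 / (N : ℝ) ^ 2))))) := tau_nonneg hN hr0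
    positivity
  refine (levelTwo_algebraWAQB hN rfl rfl rfl rfl rfl rfl hr0 hB hB0 hD0 hL (frobNorm_le_sqrt_mul_matrixOpNorm B) hW0 hZ1 hZ2
    (sqrt_integral_normSq_quadBB_le_scale hN B) (frobNorm_mul_sqrt_integral_normSq_quadDB_le hN B Δ) hKQ hnM hlin
    (sqrt_integral_Gam_upsi_le_omegaPlus hN B Δ) (sqrt_integral_Gam_c3prime_le_quad hN B Δ) hcov).trans (le_of_eq ?_)
  rw [levelTwo_idW1 hNne, levelTwo_idW2 hNne]

/-! ### Monotonicity and the modulus -/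

/-- `0 ≤ K₂Q(N, r)` for `0 ≤ r < 1/2` (`N ≥ 3`). [folklore] -/
theorem levelTwoQ_nonneg (hN : 3 ≤ N) {r : ℝ} (hr : 0 ≤ r) (hr2 : r < 1 / 2) : 0 ≤ ((N : ℝ) ^ 2 / ((N : ℝ) ^ 2 - 1)) *
        (Real.sqrt ((1 +
            (2 * ((N : ℝ) * (2 * (N : ℝ) - 4 / N) / ((2 * (N : ℝ) - 4 / N) ^ 2 - 4)) *
            (r + (r ^ 2 / 2 + r * Real.sqrt (r ^ 2 / 4 + 1 / (N : ℝ) ^ 2)))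
          + 2 * (2 * (N : ℝ) / ((2 * (N : ℝ) - 4 / N) ^ 2 - 4)) * N *
            ((r ^ 2 / 2 + r * Real.sqrt (r ^ 2 / 4 + 1 / (N : ℝ) ^ 2))
              + r * (r / 2 + Real.sqrt (r ^ 2 / 4 + 1 / (N : ℝ) ^ 2)) ^ 2))) / 2)
          + ((N : ℝ) ^ 2 / (2 * ((N : ℝ) ^ 2 - 4))) * r + 2 * (((N : ℝ) ^ 2 / (2 * ((N : ℝ) ^ 2 - 4))) + 1 / 4) * (r ^ 2 / 2 + r * Real.sqrt (r ^ 2 / 4 + 1 / (N : ℝ) ^ 2))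
          + (3 * ((N : ℝ) ^ 2 / (2 * ((N : ℝ) ^ 2 - 4))) * r ^ 2 + (2 * ((N : ℝ) ^ 2 / (2 * ((N : ℝ) ^ 2 - 4))) + 1 / 4) * (r * ((r ^ 2 * (1 + r / 2 + Real.sqrt (r ^ 2 / 4 + 1 / (N : ℝ) ^ 2)) / (2 - 4 / (N : ℝ) ^ 2)) / 2 + Real.sqrt ((r ^ 2 * (1 + r / 2 + Real.sqrt (r ^ 2 / 4 + 1 / (N : ℝ) ^ 2)) / (2 - 4 / (N : ℝ) ^ 2)) ^ 2 / 4 + (r ^ 2 * (4 / (N : ℝ) ^ 2 + 2 * (r / 2 + Real.sqrt (r ^ 2 / 4 + 1 / (N : ℝ) ^ 2)) ^ 2) / (2 - 4 / (N : ℝ) ^ 2)))))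
              + (10 * ((N : ℝ) ^ 2 / (2 * ((N : ℝ) ^ 2 - 4))) + 1 / 2) * r * (r ^ 2 / 2 + r * Real.sqrt (r ^ 2 / 4 + 1 / (N : ℝ) ^ 2))) / (1 / 2 - r)) := by
  have h3 : (3 : ℝ) ≤ N := by exact_mod_cast hN
  have : 0 ≤ (N : ℝ) ^ 2 / ((N : ℝ) ^ 2 - 1) := div_nonneg (by positivity) (by nlinarith only [h3])
  have : 0 ≤ (N : ℝ) ^ 2 / (2 * ((N : ℝ) ^ 2 - 4)) := div_nonneg (by positivity) (by nlinarith only [h3])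
  have : 0 < 1 / 2 - r := by linarith only [hr2]
  have : 0 ≤ (r * ((r ^ 2 * (1 + r / 2 + Real.sqrt (r ^ 2 / 4 + 1 / (N : ℝ) ^ 2)) / (2 - 4 / (N : ℝ) ^ 2)) / 2 + Real.sqrt ((r ^ 2 * (1 + r / 2 + Real.sqrt (r ^ 2 / 4 + 1 / (N : ℝ) ^ 2)) / (2 - 4 / (N : ℝ) ^ 2)) ^ 2 / 4 + (r ^ 2 * (4 / (N : ℝ) ^ 2 + 2 * (r / 2 + Real.sqrt (r ^ 2 / 4 + 1 / (N : ℝ) ^ 2)) ^ 2) / (2 - 4 / (N : ℝ) ^ 2))))) := tau_nonneg hN hr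
  positivity

/-- The Bakry–Émery bracket of `K₂B(N, ·)` is increasing on `[0, 1/2)` (with `E` abstract, `E ≥ 0`). [folklore] -/
theorem levelTwoBFrac_mono (hN : 3 ≤ N) {E r R : ℝ} (hE0 : 0 ≤ E) (hr : 0 ≤ r) (hrR : r ≤ R) (hR : R < 1 / 2) :
    (3 / 2 * E * r ^ 2 + (2 * E + 1 / 4) * (r * ((r ^ 2 * (1 + r / 2 + Real.sqrt (r ^ 2 / 4 + 1 / (N : ℝ) ^ 2)) / (2 - 4 / (N : ℝ) ^ 2)) / 2 + Real.sqrt ((r ^ 2 * (1 + r / 2 + Real.sqrt (r ^ 2 / 4 + 1 / (N : ℝ) ^ 2)) / (2 - 4 / (N : ℝ) ^ 2)) ^ 2 / 4 + (r ^ 2 * (4 / (N : ℝ) ^ 2 + 2 * (r / 2 + Real.sqrt (r ^ 2 / 4 + 1 / (N : ℝ) ^ 2)) ^ 2) / (2 - 4 / (N : ℝ) ^ 2)))))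
        + (10 * E + 1 / 2) * r * (r ^ 2 / 2 + r * Real.sqrt (r ^ 2 / 4 + 1 / (N : ℝ) ^ 2))) / (1 / 2 - r) ≤
      (3 / 2 * E * R ^ 2 + (2 * E + 1 / 4) * (R * ((R ^ 2 * (1 + R / 2 + Real.sqrt (R ^ 2 / 4 + 1 / (N : ℝ) ^ 2)) / (2 - 4 / (N : ℝ) ^ 2)) / 2 + Real.sqrt ((R ^ 2 * (1 + R / 2 + Real.sqrt (R ^ 2 / 4 + 1 / (N : ℝ) ^ 2)) / (2 - 4 / (N : ℝ) ^ 2)) ^ 2 / 4 + (R ^ 2 * (4 / (N : ℝ) ^ 2 + 2 * (R / 2 + Real.sqrt (R ^ 2 / 4 + 1 / (N : ℝ) ^ 2)) ^ 2) / (2 - 4 / (N : ℝ) ^ 2)))))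
        + (10 * E + 1 / 2) * R * (R ^ 2 / 2 + R * Real.sqrt (R ^ 2 / 4 + 1 / (N : ℝ) ^ 2))) / (1 / 2 - R) := by
  have hR0 : 0 ≤ R := hr.trans hrR
  have h1 : 0 < 1 / 2 - R := by linarith only [hR]
  have p2 : r ^ 2 ≤ R ^ 2 := pow_le_pow_left₀ hr hrR 2
  have hs : Real.sqrt (r ^ 2 / 4 + 1 / (N : ℝ) ^ 2) ≤ Real.sqrt (R ^ 2 / 4 + 1 / (N : ℝ) ^ 2) :=
    Real.sqrt_le_sqrt (by linarith only [p2])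
  have hw : r ^ 2 / 2 + r * Real.sqrt (r ^ 2 / 4 + 1 / (N : ℝ) ^ 2) ≤ R ^ 2 / 2 + R * Real.sqrt (R ^ 2 / 4 + 1 / (N : ℝ) ^ 2) := by
    have := mul_le_mul hrR hs (Real.sqrt_nonneg _) hR0
    linarith only [this, p2]
  have hw0 : 0 ≤ r ^ 2 / 2 + r * Real.sqrt (r ^ 2 / 4 + 1 / (N : ℝ) ^ 2) := levelTwoS_om_nonneg hr
  have hrw : r * (r ^ 2 / 2 + r * Real.sqrt (r ^ 2 / 4 + 1 / (N : ℝ) ^ 2)) ≤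
      R * (R ^ 2 / 2 + R * Real.sqrt (R ^ 2 / 4 + 1 / (N : ℝ) ^ 2)) := mul_le_mul hrR hw hw0 hR0
  have ht := tau_mono hN hr hrR
  have ht0 := tau_nonneg hN hr
  have hnum : 3 / 2 * E * r ^ 2 + (2 * E + 1 / 4) * (r * ((r ^ 2 * (1 + r / 2 + Real.sqrt (r ^ 2 / 4 + 1 / (N : ℝ) ^ 2)) / (2 - 4 / (N : ℝ) ^ 2)) / 2 + Real.sqrt ((r ^ 2 * (1 + r / 2 + Real.sqrt (r ^ 2 / 4 + 1 / (N : ℝ) ^ 2)) / (2 - 4 / (N : ℝ) ^ 2)) ^ 2 / 4 + (r ^ 2 * (4 / (N : ℝ) ^ 2 + 2 * (r / 2 + Real.sqrt (r ^ 2 / 4 + 1 / (N : ℝ) ^ 2)) ^ 2) / (2 - 4 / (N : ℝ) ^ 2)))))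
        + (10 * E + 1 / 2) * r * (r ^ 2 / 2 + r * Real.sqrt (r ^ 2 / 4 + 1 / (N : ℝ) ^ 2)) ≤
      3 / 2 * E * R ^ 2 + (2 * E + 1 / 4) * (R * ((R ^ 2 * (1 + R / 2 + Real.sqrt (R ^ 2 / 4 + 1 / (N : ℝ) ^ 2)) / (2 - 4 / (N : ℝ) ^ 2)) / 2 + Real.sqrt ((R ^ 2 * (1 + R / 2 + Real.sqrt (R ^ 2 / 4 + 1 / (N : ℝ) ^ 2)) / (2 - 4 / (N : ℝ) ^ 2)) ^ 2 / 4 + (R ^ 2 * (4 / (N : ℝ) ^ 2 + 2 * (R / 2 + Real.sqrt (R ^ 2 / 4 + 1 / (N : ℝ) ^ 2)) ^ 2) / (2 - 4 / (N : ℝ) ^ 2)))))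
        + (10 * E + 1 / 2) * R * (R ^ 2 / 2 + R * Real.sqrt (R ^ 2 / 4 + 1 / (N : ℝ) ^ 2)) := by
    have a1 := mul_le_mul_of_nonneg_left p2 (by positivity : (0 : ℝ) ≤ 3 / 2 * E)
    have a2 := mul_le_mul_of_nonneg_left hrw (by positivity : (0 : ℝ) ≤ 10 * E + 1 / 2)
    have a3 := mul_le_mul_of_nonneg_left ht (by positivity : (0 : ℝ) ≤ 2 * E + 1 / 4)
    have e1 : (10 * E + 1 / 2) * r * (r ^ 2 / 2 + r * Real.sqrt (r ^ 2 / 4 + 1 / (N : ℝ) ^ 2)) =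
        (10 * E + 1 / 2) * (r * (r ^ 2 / 2 + r * Real.sqrt (r ^ 2 / 4 + 1 / (N : ℝ) ^ 2))) := by ring
    have e2 : (10 * E + 1 / 2) * R * (R ^ 2 / 2 + R * Real.sqrt (R ^ 2 / 4 + 1 / (N : ℝ) ^ 2)) =
        (10 * E + 1 / 2) * (R * (R ^ 2 / 2 + R * Real.sqrt (R ^ 2 / 4 + 1 / (N : ℝ) ^ 2))) := by ring
    rw [e1, e2]
    linarith only [a1, a2, a3]
  have hnum0 : 0 ≤ 3 / 2 * E * r ^ 2 + (2 * E + 1 / 4) * (r * ((r ^ 2 * (1 + r / 2 + Real.sqrt (r ^ 2 / 4 + 1 / (N : ℝ) ^ 2)) / (2 - 4 / (N : ℝ) ^ 2)) / 2 + Real.sqrt ((r ^ 2 * (1 + r / 2 + Real.sqrt (r ^ 2 / 4 + 1 / (N : ℝ) ^ 2)) / (2 - 4 / (N : ℝ) ^ 2)) ^ 2 / 4 + (r ^ 2 * (4 / (N : ℝ) ^ 2 + 2 * (r / 2 + Real.sqrt (r ^ 2 / 4 + 1 / (N : ℝ) ^ 2)) ^ 2) / (2 - 4 / (N : ℝ)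 ^ 2)))))
        + (10 * E + 1 / 2) * r * (r ^ 2 / 2 + r * Real.sqrt (r ^ 2 / 4 + 1 / (N : ℝ) ^ 2)) := by positivity
  exact div_le_div₀ (hnum0.trans hnum) hnum h1 (by linarith only [hrR] : 1 / 2 - R ≤ 1 / 2 - r)

set_option maxHeartbeats 400000 in
/-- `K₂B(N, ·)` is increasing on `[0, 1/2)` (the statement alone is ≈ 10 kB of real arithmetic: double heartbeats for its
elaboration, as in `FluxBoundFour`). [folklore] -/
theorem levelTwoBBody_mono (hN : 3 ≤ N) {r R : ℝ} (hr : 0 ≤ r) (hrR : r ≤ R) (hR : R < 1 / 2) :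
    ((N : ℝ) ^ 2 / ((N : ℝ) ^ 2 - 1)) *
        (Real.sqrt ((1 +
            (2 * ((N : ℝ) * (2 * (N : ℝ) - 4 / N) / ((2 * (N : ℝ) - 4 / N) ^ 2 - 4)) *
            (r + (r ^ 2 / 2 + r * Real.sqrt (r ^ 2 / 4 + 1 / (N : ℝ) ^ 2)))
          + 2 * (2 * (N : ℝ) / ((2 * (N : ℝ) - 4 / N) ^ 2 - 4)) * N *
            ((r ^ 2 / 2 + r * Real.sqrt (r ^ 2 / 4 + 1 / (N : ℝ) ^ 2))
              + r * (r / 2 + Real.sqrt (r ^ 2 / 4 + 1 / (N : ℝ) ^ 2)) ^ 2))) / 2)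
          + ((N : ℝ) ^ 2 / (2 * ((N : ℝ) ^ 2 - 4))) * r + 2 * (((N : ℝ) ^ 2 / (2 * ((N : ℝ) ^ 2 - 4))) + 1 / 4) * (r ^ 2 / 2 + r * Real.sqrt (r ^ 2 / 4 + 1 / (N : ℝ) ^ 2))
          + (3 / 2 * ((N : ℝ) ^ 2 / (2 * ((N : ℝ) ^ 2 - 4))) * r ^ 2 + (2 * ((N : ℝ) ^ 2 / (2 * ((N : ℝ) ^ 2 - 4))) + 1 / 4) * (r * ((r ^ 2 * (1 + r / 2 + Real.sqrt (r ^ 2 / 4 + 1 / (N : ℝ) ^ 2)) / (2 - 4 / (N : ℝ) ^ 2)) / 2 + Real.sqrt ((r ^ 2 * (1 + r / 2 + Real.sqrt (r ^ 2 / 4 + 1 / (N : ℝ) ^ 2)) / (2 - 4 / (N : ℝ) ^ 2)) ^ 2 / 4 + (r ^ 2 * (4 / (N : ℝ) ^ 2 + 2 * (r / 2 + Real.sqrt (r ^ 2 / 4 + 1 / (N : ℝ) ^ 2)) ^ 2) / (2 - 4 / (N : ℝ) ^ 2)))))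
              + (10 * ((N : ℝ) ^ 2 / (2 * ((N : ℝ) ^ 2 - 4))) + 1 / 2) * r * (r ^ 2 / 2 + r * Real.sqrt (r ^ 2 / 4 + 1 / (N : ℝ) ^ 2))) / (1 / 2 - r)
          + 3 / 2 * ((N : ℝ) ^ 2 / (2 * ((N : ℝ) ^ 2 - 4))) * r ^ 2 * (((N : ℝ) ^ 2 / ((N : ℝ) ^ 2 - 1)) *
        (Real.sqrt ((1 +
            (2 * ((N : ℝ) * (2 * (N : ℝ) - 4 / N) / ((2 * (N : ℝ) - 4 / N) ^ 2 - 4)) *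
            (r + (r ^ 2 / 2 + r * Real.sqrt (r ^ 2 / 4 + 1 / (N : ℝ) ^ 2)))
          + 2 * (2 * (N : ℝ) / ((2 * (N : ℝ) - 4 / N) ^ 2 - 4)) * N *
            ((r ^ 2 / 2 + r * Real.sqrt (r ^ 2 / 4 + 1 / (N : ℝ) ^ 2))
              + r * (r / 2 + Real.sqrt (r ^ 2 / 4 + 1 / (N : ℝ) ^ 2)) ^ 2))) / 2)
          + ((N : ℝ) ^ 2 / (2 * ((N : ℝ) ^ 2 - 4))) * r + 2 * (((N : ℝ) ^ 2 / (2 * ((N : ℝ) ^ 2 - 4))) + 1 / 4) * (r ^ 2 / 2 + r * Real.sqrt (r ^ 2 / 4 + 1 / (N : ℝ) ^ 2))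
          + (3 * ((N : ℝ) ^ 2 / (2 * ((N : ℝ) ^ 2 - 4))) * r ^ 2 + (2 * ((N : ℝ) ^ 2 / (2 * ((N : ℝ) ^ 2 - 4))) + 1 / 4) * (r * ((r ^ 2 * (1 + r / 2 + Real.sqrt (r ^ 2 / 4 + 1 / (N : ℝ) ^ 2)) / (2 - 4 / (N : ℝ) ^ 2)) / 2 + Real.sqrt ((r ^ 2 * (1 + r / 2 + Real.sqrt (r ^ 2 / 4 + 1 / (N : ℝ) ^ 2)) / (2 - 4 / (N : ℝ) ^ 2)) ^ 2 / 4 + (r ^ 2 * (4 / (N : ℝ) ^ 2 + 2 * (r / 2 + Real.sqrt (r ^ 2 / 4 + 1 / (N : ℝ) ^ 2)) ^ 2) / (2 - 4 / (N : ℝ) ^ 2)))))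
              + (10 * ((N : ℝ) ^ 2 / (2 * ((N : ℝ) ^ 2 - 4))) + 1 / 2) * r * (r ^ 2 / 2 + r * Real.sqrt (r ^ 2 / 4 + 1 / (N : ℝ) ^ 2))) / (1 / 2 - r)))) ≤
      ((N : ℝ) ^ 2 / ((N : ℝ) ^ 2 - 1)) *
        (Real.sqrt ((1 +
            (2 * ((N : ℝ) * (2 * (N : ℝ) - 4 / N) / ((2 * (N : ℝ) - 4 / N) ^ 2 - 4)) *
            (R + (R ^ 2 / 2 + R * Real.sqrt (R ^ 2 / 4 + 1 / (N : ℝ) ^ 2)))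
          + 2 * (2 * (N : ℝ) / ((2 * (N : ℝ) - 4 / N) ^ 2 - 4)) * N *
            ((R ^ 2 / 2 + R * Real.sqrt (R ^ 2 / 4 + 1 / (N : ℝ) ^ 2))
              + R * (R / 2 + Real.sqrt (R ^ 2 / 4 + 1 / (N : ℝ) ^ 2)) ^ 2))) / 2)
          + ((N : ℝ) ^ 2 / (2 * ((N : ℝ) ^ 2 - 4))) * R + 2 * (((N : ℝ) ^ 2 / (2 * ((N : ℝ) ^ 2 - 4))) + 1 / 4) * (R ^ 2 / 2 + R * Real.sqrt (R ^ 2 / 4 + 1 / (N : ℝ) ^ 2))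
          + (3 / 2 * ((N : ℝ) ^ 2 / (2 * ((N : ℝ) ^ 2 - 4))) * R ^ 2 + (2 * ((N : ℝ) ^ 2 / (2 * ((N : ℝ) ^ 2 - 4))) + 1 / 4) * (R * ((R ^ 2 * (1 + R / 2 + Real.sqrt (R ^ 2 / 4 + 1 / (N : ℝ) ^ 2)) / (2 - 4 / (N : ℝ) ^ 2)) / 2 + Real.sqrt ((R ^ 2 * (1 + R / 2 + Real.sqrt (R ^ 2 / 4 + 1 / (N : ℝ) ^ 2)) / (2 - 4 / (N : ℝ) ^ 2)) ^ 2 / 4 + (R ^ 2 * (4 / (N : ℝ) ^ 2 + 2 * (R / 2 + Real.sqrt (R ^ 2 / 4 + 1 / (N : ℝ) ^ 2)) ^ 2) / (2 - 4 / (N : ℝ) ^ 2)))))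
              + (10 * ((N : ℝ) ^ 2 / (2 * ((N : ℝ) ^ 2 - 4))) + 1 / 2) * R * (R ^ 2 / 2 + R * Real.sqrt (R ^ 2 / 4 + 1 / (N : ℝ) ^ 2))) / (1 / 2 - R)
          + 3 / 2 * ((N : ℝ) ^ 2 / (2 * ((N : ℝ) ^ 2 - 4))) * R ^ 2 * (((N : ℝ) ^ 2 / ((N : ℝ) ^ 2 - 1)) *
        (Real.sqrt ((1 +
            (2 * ((N : ℝ) * (2 * (N : ℝ) - 4 / N) / ((2 * (N : ℝ) - 4 / N) ^ 2 - 4)) *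
            (R + (R ^ 2 / 2 + R * Real.sqrt (R ^ 2 / 4 + 1 / (N : ℝ) ^ 2)))
          + 2 * (2 * (N : ℝ) / ((2 * (N : ℝ) - 4 / N) ^ 2 - 4)) * N *
            ((R ^ 2 / 2 + R * Real.sqrt (R ^ 2 / 4 + 1 / (N : ℝ) ^ 2))
              + R * (R / 2 + Real.sqrt (R ^ 2 / 4 + 1 / (N : ℝ) ^ 2)) ^ 2))) / 2)
          + ((N : ℝ) ^ 2 / (2 * ((N : ℝ) ^ 2 - 4))) * R + 2 * (((N : ℝ) ^ 2 / (2 * ((N : ℝ) ^ 2 - 4))) + 1 / 4) * (R ^ 2 / 2 + R * Real.sqrt (R ^ 2 / 4 + 1 / (N : ℝ) ^ 2))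
          + (3 * ((N : ℝ) ^ 2 / (2 * ((N : ℝ) ^ 2 - 4))) * R ^ 2 + (2 * ((N : ℝ) ^ 2 / (2 * ((N : ℝ) ^ 2 - 4))) + 1 / 4) * (R * ((R ^ 2 * (1 + R / 2 + Real.sqrt (R ^ 2 / 4 + 1 / (N : ℝ) ^ 2)) / (2 - 4 / (N : ℝ) ^ 2)) / 2 + Real.sqrt ((R ^ 2 * (1 + R / 2 + Real.sqrt (R ^ 2 / 4 + 1 / (N : ℝ) ^ 2)) / (2 - 4 / (N : ℝ) ^ 2)) ^ 2 / 4 + (R ^ 2 * (4 / (N : ℝ) ^ 2 + 2 * (R / 2 + Real.sqrt (R ^ 2 / 4 + 1 / (N : ℝ) ^ 2)) ^ 2) / (2 - 4 / (N : ℝ) ^ 2)))))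
              + (10 * ((N : ℝ) ^ 2 / (2 * ((N : ℝ) ^ 2 - 4))) + 1 / 2) * R * (R ^ 2 / 2 + R * Real.sqrt (R ^ 2 / 4 + 1 / (N : ℝ) ^ 2))) / (1 / 2 - R)))) := by
  have h3 : (3 : ℝ) ≤ N := by exact_mod_cast hN
  have hN1 : (0 : ℝ) < (N : ℝ) ^ 2 - 1 := by nlinarith only [h3]
  have hC0 : 0 ≤ (N : ℝ) ^ 2 / ((N : ℝ) ^ 2 - 1) := div_nonneg (by positivity) hN1.le
  have hE0 : 0 ≤ (N : ℝ) ^ 2 / (2 * ((N : ℝ) ^ 2 - 4)) := div_nonneg (by positivity) (by nlinarith only [h3])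
  have hR0 : 0 ≤ R := hr.trans hrR
  have hr2 : r < 1 / 2 := lt_of_le_of_lt hrR hR
  have p2 : r ^ 2 ≤ R ^ 2 := pow_le_pow_left₀ hr hrR 2
  have hs : Real.sqrt (r ^ 2 / 4 + 1 / (N : ℝ) ^ 2) ≤ Real.sqrt (R ^ 2 / 4 + 1 / (N : ℝ) ^ 2) :=
    Real.sqrt_le_sqrt (by linarith only [p2])
  have hw : r ^ 2 / 2 + r * Real.sqrt (r ^ 2 / 4 + 1 / (N : ℝ) ^ 2) ≤ R ^ 2 / 2 + R * Real.sqrt (R ^ 2 / 4 + 1 / (N : ℝ) ^ 2) := by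
    have := mul_le_mul hrR hs (Real.sqrt_nonneg _) hR0
    linarith only [this, p2]
  have hq := levelTwoQBody_mono hN hr hrR hR
  have hq0 := levelTwoQ_nonneg hN hr hr2
  have hfrac := levelTwoBFrac_mono hN hE0 hr hrR hR
  have h32 : 0 ≤ 3 / 2 * ((N : ℝ) ^ 2 / (2 * ((N : ℝ) ^ 2 - 4))) * R ^ 2 := by positivity
  have hnest := mul_le_mul (mul_le_mul_of_nonneg_left p2 (by positivity : (0 : ℝ) ≤ 3 / 2 * ((N : ℝ) ^ 2 / (2 * ((N : ℝ) ^ 2 - 4)))))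
    hq hq0 h32
  have b0 : Real.sqrt ((1 +
            (2 * ((N : ℝ) * (2 * (N : ℝ) - 4 / N) / ((2 * (N : ℝ) - 4 / N) ^ 2 - 4)) *
            (r + (r ^ 2 / 2 + r * Real.sqrt (r ^ 2 / 4 + 1 / (N : ℝ) ^ 2)))
          + 2 * (2 * (N : ℝ) / ((2 * (N : ℝ) - 4 / N) ^ 2 - 4)) * N *
            ((r ^ 2 / 2 + r * Real.sqrt (r ^ 2 / 4 + 1 / (N : ℝ) ^ 2))
              + r * (r / 2 + Real.sqrt (r ^ 2 / 4 + 1 / (N : ℝ) ^ 2)) ^ 2))) / 2) ≤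
      Real.sqrt ((1 +
            (2 * ((N : ℝ) * (2 * (N : ℝ) - 4 / N) / ((2 * (N : ℝ) - 4 / N) ^ 2 - 4)) *
            (R + (R ^ 2 / 2 + R * Real.sqrt (R ^ 2 / 4 + 1 / (N : ℝ) ^ 2)))
          + 2 * (2 * (N : ℝ) / ((2 * (N : ℝ) - 4 / N) ^ 2 - 4)) * N *
            ((R ^ 2 / 2 + R * Real.sqrt (R ^ 2 / 4 + 1 / (N : ℝ) ^ 2))
              + R * (R / 2 + Real.sqrt (R ^ 2 / 4 + 1 / (N : ℝ) ^ 2)) ^ 2))) / 2) :=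
    Real.sqrt_le_sqrt (by linarith only [omegaPlus_mono hN hr hrR])
  have b1 := mul_le_mul_of_nonneg_left hrR hE0
  have b2 := mul_le_mul_of_nonneg_left hw (by positivity : (0 : ℝ) ≤ 2 * ((N : ℝ) ^ 2 / (2 * ((N : ℝ) ^ 2 - 4)) + 1 / 4))
  exact mul_le_mul_of_nonneg_left (add_le_add (add_le_add (add_le_add (add_le_add b0 b1) b2) hfrac) hnest) hC0

set_option maxHeartbeats 400000 in
/-- **THE LINEAR-BOOTSTRAP LEVEL-TWO ONE-LINK KANTOROVICH–RUBINSTEIN MODULUS, EVERY `SU(N)`, `N ≥ 3`, HYPOTHESIS-FREE**: for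
`R < 1/2`, `OneLinkKRModulus N R (K₂B(N,R))`. [cite: arXiv220412737, Lemma 4.1 and Rem. 1.3] -/
theorem oneLinkKRModulus_levelTwoB (hN : 3 ≤ N) {R : ℝ} (hR : R < 1 / 2) :
    OneLinkKRModulus N R
      (((N : ℝ) ^ 2 / ((N : ℝ) ^ 2 - 1)) *
        (Real.sqrt ((1 +
            (2 * ((N : ℝ) * (2 * (N : ℝ) - 4 / N) / ((2 * (N : ℝ) - 4 / N) ^ 2 - 4)) *
            (R + (R ^ 2 / 2 + R * Real.sqrt (R ^ 2 / 4 + 1 / (N : ℝ) ^ 2)))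
          + 2 * (2 * (N : ℝ) / ((2 * (N : ℝ) - 4 / N) ^ 2 - 4)) * N *
            ((R ^ 2 / 2 + R * Real.sqrt (R ^ 2 / 4 + 1 / (N : ℝ) ^ 2))
              + R * (R / 2 + Real.sqrt (R ^ 2 / 4 + 1 / (N : ℝ) ^ 2)) ^ 2))) / 2)
          + ((N : ℝ) ^ 2 / (2 * ((N : ℝ) ^ 2 - 4))) * R + 2 * (((N : ℝ) ^ 2 / (2 * ((N : ℝ) ^ 2 - 4))) + 1 / 4) * (R ^ 2 / 2 + R * Real.sqrt (R ^ 2 / 4 + 1 / (N : ℝ) ^ 2))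
          + (3 / 2 * ((N : ℝ) ^ 2 / (2 * ((N : ℝ) ^ 2 - 4))) * R ^ 2 + (2 * ((N : ℝ) ^ 2 / (2 * ((N : ℝ) ^ 2 - 4))) + 1 / 4) * (R * ((R ^ 2 * (1 + R / 2 + Real.sqrt (R ^ 2 / 4 + 1 / (N : ℝ) ^ 2)) / (2 - 4 / (N : ℝ) ^ 2)) / 2 + Real.sqrt ((R ^ 2 * (1 + R / 2 + Real.sqrt (R ^ 2 / 4 + 1 / (N : ℝ) ^ 2)) / (2 - 4 / (N : ℝ) ^ 2)) ^ 2 / 4 + (R ^ 2 * (4 / (N : ℝ) ^ 2 + 2 * (R / 2 + Real.sqrt (R ^ 2 / 4 + 1 / (N : ℝ) ^ 2)) ^ 2) / (2 - 4 / (N : ℝ) ^ 2)))))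
              + (10 * ((N : ℝ) ^ 2 / (2 * ((N : ℝ) ^ 2 - 4))) + 1 / 2) * R * (R ^ 2 / 2 + R * Real.sqrt (R ^ 2 / 4 + 1 / (N : ℝ) ^ 2))) / (1 / 2 - R)
          + 3 / 2 * ((N : ℝ) ^ 2 / (2 * ((N : ℝ) ^ 2 - 4))) * R ^ 2 * (((N : ℝ) ^ 2 / ((N : ℝ) ^ 2 - 1)) *
        (Real.sqrt ((1 +
            (2 * ((N : ℝ) * (2 * (N : ℝ) - 4 / N) / ((2 * (N : ℝ) - 4 / N) ^ 2 - 4)) *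
            (R + (R ^ 2 / 2 + R * Real.sqrt (R ^ 2 / 4 + 1 / (N : ℝ) ^ 2)))
          + 2 * (2 * (N : ℝ) / ((2 * (N : ℝ) - 4 / N) ^ 2 - 4)) * N *
            ((R ^ 2 / 2 + R * Real.sqrt (R ^ 2 / 4 + 1 / (N : ℝ) ^ 2))
              + R * (R / 2 + Real.sqrt (R ^ 2 / 4 + 1 / (N : ℝ) ^ 2)) ^ 2))) / 2)
          + ((N : ℝ) ^ 2 / (2 * ((N : ℝ) ^ 2 - 4))) * R + 2 * (((N : ℝ) ^ 2 / (2 * ((N : ℝ) ^ 2 - 4))) + 1 / 4) * (R ^ 2 / 2 + R * Real.sqrt (R ^ 2 / 4 + 1 / (N : ℝ) ^ 2))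
          + (3 * ((N : ℝ) ^ 2 / (2 * ((N : ℝ) ^ 2 - 4))) * R ^ 2 + (2 * ((N : ℝ) ^ 2 / (2 * ((N : ℝ) ^ 2 - 4))) + 1 / 4) * (R * ((R ^ 2 * (1 + R / 2 + Real.sqrt (R ^ 2 / 4 + 1 / (N : ℝ) ^ 2)) / (2 - 4 / (N : ℝ) ^ 2)) / 2 + Real.sqrt ((R ^ 2 * (1 + R / 2 + Real.sqrt (R ^ 2 / 4 + 1 / (N : ℝ) ^ 2)) / (2 - 4 / (N : ℝ) ^ 2)) ^ 2 / 4 + (R ^ 2 * (4 / (N : ℝ) ^ 2 + 2 * (R / 2 + Real.sqrt (R ^ 2 / 4 + 1 / (N : ℝ) ^ 2)) ^ 2) / (2 - 4 / (N : ℝ) ^ 2)))))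
              + (10 * ((N : ℝ) ^ 2 / (2 * ((N : ℝ) ^ 2 - 4))) + 1 / 2) * R * (R ^ 2 / 2 + R * Real.sqrt (R ^ 2 / 4 + 1 / (N : ℝ) ^ 2))) / (1 / 2 - R))))) := by
  classical
  intro B B' hB hB' φ L hφm hφb hL hφL
  have hN0 : N ≠ 0 := by omega
  have hNpos : (0 : ℝ) < N := Nat.cast_pos.2 (Nat.pos_of_ne_zero hN0)
  set f : SUN N → ℝ := fun g => (N : ℝ) * ((g : Matrix (Fin N) (Fin N) ℂ) * B).trace.re with hf
  set w : SUN N → ℝ := fun g => (N : ℝ) * ((g : Matrix (Fin N) (Fin N) ℂ) * (B' - B)).trace.re with hw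
  have hfw : (fun g : SUN N => (N : ℝ) * ((g : Matrix (Fin N) (Fin N) ℂ) * B').trace.re) = fun g => f g + w g := by
    funext g
    simp only [hf, hw, Matrix.mul_sub, trace_sub, Complex.sub_re]
    ring
  rw [hfw, abs_sub_comm]
  have hfm : Measurable f := (continuous_const.mul (continuous_re_trace_su_mul B)).measurable
  have hwm : Measurable w := (continuous_const.mul (continuous_re_trace_su_mul (B' - B))).measurable
  have hfb : ∃ C, ∀ s, |f s| ≤ C := ⟨(N : ℝ) * (Real.sqrt N * frobNorm B), fun s => by
    simp only [hf]
    rw [abs_mul, abs_of_nonneg hNpos.le]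
    exact mul_le_mul_of_nonneg_left (abs_re_trace_su_mul_le s B) hNpos.le⟩
  have hwb : ∀ s, |w s| ≤ (N : ℝ) * (Real.sqrt N * frobNorm (B' - B)) := fun s => by
    simp only [hw]
    rw [abs_mul, abs_of_nonneg hNpos.le]
    exact mul_le_mul_of_nonneg_left (abs_re_trace_su_mul_le s _) hNpos.le
  have key := abs_integral_tilted_add_sub_le_of_cov (μ := haarProbability (SUN N))
    (A := (((N : ℝ) ^ 2 / ((N : ℝ) ^ 2 - 1)) *
        (Real.sqrt ((1 +
            (2 * ((N : ℝ) * (2 * (N : ℝ) - 4 / N) / ((2 * (N : ℝ) - 4 / N) ^ 2 - 4)) *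
            (R + (R ^ 2 / 2 + R * Real.sqrt (R ^ 2 / 4 + 1 / (N : ℝ) ^ 2)))
          + 2 * (2 * (N : ℝ) / ((2 * (N : ℝ) - 4 / N) ^ 2 - 4)) * N *
            ((R ^ 2 / 2 + R * Real.sqrt (R ^ 2 / 4 + 1 / (N : ℝ) ^ 2))
              + R * (R / 2 + Real.sqrt (R ^ 2 / 4 + 1 / (N : ℝ) ^ 2)) ^ 2))) / 2)
          + ((N : ℝ) ^ 2 / (2 * ((N : ℝ) ^ 2 - 4))) * R + 2 * (((N : ℝ) ^ 2 / (2 * ((N : ℝ) ^ 2 - 4))) + 1 / 4) * (R ^ 2 / 2 + R * Real.sqrt (R ^ 2 / 4 + 1 / (N : ℝ) ^ 2))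
          + (3 / 2 * ((N : ℝ) ^ 2 / (2 * ((N : ℝ) ^ 2 - 4))) * R ^ 2 + (2 * ((N : ℝ) ^ 2 / (2 * ((N : ℝ) ^ 2 - 4))) + 1 / 4) * (R * ((R ^ 2 * (1 + R / 2 + Real.sqrt (R ^ 2 / 4 + 1 / (N : ℝ) ^ 2)) / (2 - 4 / (N : ℝ) ^ 2)) / 2 + Real.sqrt ((R ^ 2 * (1 + R / 2 + Real.sqrt (R ^ 2 / 4 + 1 / (N : ℝ) ^ 2)) / (2 - 4 / (N : ℝ) ^ 2)) ^ 2 / 4 + (R ^ 2 * (4 / (N : ℝ) ^ 2 + 2 * (R / 2 + Real.sqrt (R ^ 2 / 4 + 1 / (N : ℝ) ^ 2)) ^ 2) / (2 - 4 / (N : ℝ) ^ 2)))))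
              + (10 * ((N : ℝ) ^ 2 / (2 * ((N : ℝ) ^ 2 - 4))) + 1 / 2) * R * (R ^ 2 / 2 + R * Real.sqrt (R ^ 2 / 4 + 1 / (N : ℝ) ^ 2))) / (1 / 2 - R)
          + 3 / 2 * ((N : ℝ) ^ 2 / (2 * ((N : ℝ) ^ 2 - 4))) * R ^ 2 * (((N : ℝ) ^ 2 / ((N : ℝ) ^ 2 - 1)) *
        (Real.sqrt ((1 +
            (2 * ((N : ℝ) * (2 * (N : ℝ) - 4 / N) / ((2 * (N : ℝ) - 4 / N) ^ 2 - 4)) *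
            (R + (R ^ 2 / 2 + R * Real.sqrt (R ^ 2 / 4 + 1 / (N : ℝ) ^ 2)))
          + 2 * (2 * (N : ℝ) / ((2 * (N : ℝ) - 4 / N) ^ 2 - 4)) * N *
            ((R ^ 2 / 2 + R * Real.sqrt (R ^ 2 / 4 + 1 / (N : ℝ) ^ 2))
              + R * (R / 2 + Real.sqrt (R ^ 2 / 4 + 1 / (N : ℝ) ^ 2)) ^ 2))) / 2)
          + ((N : ℝ) ^ 2 / (2 * ((N : ℝ) ^ 2 - 4))) * R + 2 * (((N : ℝ) ^ 2 / (2 * ((N : ℝ) ^ 2 - 4))) + 1 / 4) * (R ^ 2 / 2 + R * Real.sqrt (R ^ 2 / 4 + 1 / (N : ℝ) ^ 2))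
          + (3 * ((N : ℝ) ^ 2 / (2 * ((N : ℝ) ^ 2 - 4))) * R ^ 2 + (2 * ((N : ℝ) ^ 2 / (2 * ((N : ℝ) ^ 2 - 4))) + 1 / 4) * (R * ((R ^ 2 * (1 + R / 2 + Real.sqrt (R ^ 2 / 4 + 1 / (N : ℝ) ^ 2)) / (2 - 4 / (N : ℝ) ^ 2)) / 2 + Real.sqrt ((R ^ 2 * (1 + R / 2 + Real.sqrt (R ^ 2 / 4 + 1 / (N : ℝ) ^ 2)) / (2 - 4 / (N : ℝ) ^ 2)) ^ 2 / 4 + (R ^ 2 * (4 / (N : ℝ) ^ 2 + 2 * (R / 2 + Real.sqrt (R ^ 2 / 4 + 1 / (N : ℝ) ^ 2)) ^ 2) / (2 - 4 / (N : ℝ) ^ 2)))))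
              + (10 * ((N : ℝ) ^ 2 / (2 * ((N : ℝ) ^ 2 - 4))) + 1 / 2) * R * (R ^ 2 / 2 + R * Real.sqrt (R ^ 2 / 4 + 1 / (N : ℝ) ^ 2))) / (1 / 2 - R))))) * L * frobNorm (B' - B))
    hfm hfb hwm hwb hφm hφb ?_
  · rw [frobNorm_sub_comm] at key
    exact key
  · intro t ht
    set Bt : Matrix (Fin N) (Fin N) ℂ := B + (t : ℂ) • (B' - B) with hBt
    have hft : (fun u : SUN N => f u + t * w u) =
        fun g : SUN N => (N : ℝ) * ((g : Matrix (Fin N) (Fin N) ℂ) * Bt).trace.re := by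
      funext g
      simp only [hf, hw, hBt, Matrix.mul_add, Matrix.mul_smul, trace_add, trace_smul, Complex.add_re, smul_eq_mul,
        Complex.re_ofReal_mul]
      ring
    have hBt_le : matrixOpNorm Bt ≤ R := by
      have h1 : Bt = ((1 - t : ℝ) : ℂ) • B + ((t : ℝ) : ℂ) • B' := by
        rw [hBt]; push_cast; simp only [smul_sub, sub_smul, one_smul]; abel
      rw [h1]
      calc matrixOpNorm (((1 - t : ℝ) : ℂ) • B + ((t : ℝ) : ℂ) • B')
          ≤ matrixOpNorm (((1 - t : ℝ) : ℂ) • B) + matrixOpNorm (((t : ℝ) : ℂ) • B') := matrixOpNorm_add_le _ _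
        _ = (1 - t) * matrixOpNorm B + t * matrixOpNorm B' := by
            rw [matrixOpNorm_smul, matrixOpNorm_smul, Complex.norm_real, Complex.norm_real, Real.norm_eq_abs,
              Real.norm_eq_abs, abs_of_nonneg (by linarith [ht.2]), abs_of_nonneg ht.1]
        _ ≤ (1 - t) * R + t * R :=
            add_le_add (mul_le_mul_of_nonneg_left hB (by linarith [ht.2])) (mul_le_mul_of_nonneg_left hB' ht.1)
        _ = R := by ring
    have hBt_lt : matrixOpNorm Bt < 1 / 2 := lt_of_le_of_lt hBt_le hR
    have hcov := cov_linear_le_levelTwoB_explicit hN hBt_lt (B' - B) φ hφm hφb hL hφL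
    rw [← hft] at hcov
    refine hcov.trans ?_
    have hmono := levelTwoBBody_mono hN (matrixOpNorm_nonneg Bt) hBt_le hR
    exact mul_le_mul_of_nonneg_right (mul_le_mul_of_nonneg_right hmono hL) (frobNorm_nonneg _)

end Summit.Ventures.YMGap.OneLinkEigen
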